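import Mathlib
import Literature.Computability.Complexity.RangeAvoidance
import Literature.Computability.Complexity.SignDegreeXor
import HarnessLib.Audit
import Summits.PneNP.PneNP.Theorems.QuotientSABlocks

/-!
# ROUND-22 COR-B, target B2: the per-block cycle bridge `BlockRange` (cell `pnp-ideate`)

FRONTIER range-avoidance ladder, rung F-N3 context (restricted-model lower bounds; nothing here bears on `P` vs `NP`).

`blockRange : QuotientSABlocks.BlockRange` — for every block system `A` and every target `y`,
`y ∈ Range(pstar A) ↔ π y ∈ Range(quot A)`.  Direct proof (no appeal to `PstarTyped.mem_range_typed_iff`):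
(→) along an apex triangle `{0, v⁺, w⁺}` the XOR variables of the three `P⋆` outputs cancel, so `π (P⋆(x)) = Φ(x|_A)`;
(←) given an A-assignment `z` with `Φ(z) = π y`, put `x_{β,0} := 0` and `x_{β,v} := y_{β,0v} ⊕ (z_{a(β,0,v)} ∧ z_{a(β,v,0)})`
for `v ≠ 0`: the apex outputs are right by construction and the output `{v⁺, w⁺}` is right by the apex-triangle equation.
-/

set_option linter.dupNamespace false

open Literature.Computability.Complexity
open Summit.PneNP.PneNP.Theorems.QuotientSABlocks

namespace Summit.PneNP.PneNP.Theorems.QuotientSABlockRange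

variable {s nb n' : ℕ}

/-- Encoding inverts decoding (`P⋆` outputs). -/
theorem outIdx_outDec (j : Fin (mOut s nb)) : outIdx (outDec j).1 (outDec j).2 = j := by
  simp only [outDec, outIdx, Equiv.apply_symm_apply, Prod.mk.eta]

/-- Explicit evaluation of the `P⋆` instance of a block system at the output `(β, e)`. -/
theorem pstar_eval_out (A : BlockSys s nb n') (x : Fin (nVars s nb n') → Bool) (β : Fin nb) (e : Edge s) :
    (pstar A).eval x (outIdx β e) = xor (xor (x (xv β e.1.1)) (x (xv β e.1.2)))
      (x (av (A.avar β e.1.1 e.1.2)) && x (av (A.avar β e.1.2 e.1.1))) := by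
  have h := outDec_outIdx β e
  have : (pstar A).eval x (outIdx β e) = xorAndPred (fun i => x ((pstar A).vars (outIdx β e) i)) := rfl
  rw [this, xorAndPred_apply]
  simp [pstar, h]

/-- Explicit form of the quotient map `π` at the output `(β, τ)`. -/
theorem xorQuot_tri (y : Fin (mOut s nb) → Bool) (β : Fin nb) (τ : Tri s) :
    xorQuot s nb y (triIdx β τ) =
      xor (xor (y (outIdx β (triEdge₁ τ))) (y (outIdx β (triEdge₂ τ)))) (y (outIdx β (triEdge₃ τ))) := by
  simp only [xorQuot, triDec_triIdx]

/-- Explicit evaluation of the quotient at the output `(β, τ)`, `τ = {0, v⁺, w⁺}`. -/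
theorem quot_eval_tri (A : BlockSys s nb n') (z : Fin n' → Bool) (β : Fin nb) (τ : Tri s) :
    (quot A).eval z (triIdx β τ) =
      xor (xor (z (A.avar β 0 τ.1.1.succ) && z (A.avar β τ.1.1.succ 0))
        (z (A.avar β 0 τ.1.2.succ) && z (A.avar β τ.1.2.succ 0)))
        (z (A.avar β τ.1.1.succ τ.1.2.succ) && z (A.avar β τ.1.2.succ τ.1.1.succ)) := by
  rw [quot_eval, triDec_triIdx]
  rfl

/-- The XOR variables cancel along an apex triangle. -/
theorem bool_fwd (a b c P Q R : Bool) :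
    xor (xor (xor (xor a b) P) (xor (xor a c) Q)) (xor (xor b c) R) = xor (xor P Q) R := by
  cases a <;> cases b <;> cases c <;> cases P <;> cases Q <;> cases R <;> rfl

/-- **(→)** `π (P⋆_A(x)) = Φ_A(x|_A)`. -/
theorem xorQuot_eval_pstar (A : BlockSys s nb n') (x : Fin (nVars s nb n') → Bool) :
    xorQuot s nb ((pstar A).eval x) = (quot A).eval (fun a => x (av a)) := by
  funext q
  rw [← triIdx_triDec q, xorQuot_tri, quot_eval_tri, pstar_eval_out, pstar_eval_out, pstar_eval_out]
  simp only [triEdge₁, triEdge₂, triEdge₃]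
  exact bool_fwd _ _ _ _ _ _

/-- The XOR part of the lift of a quotient preimage: `x_{β,0} = 0`, `x_{β,v} = y_{β,0v} ⊕ (z ∧ z)` for `v ≠ 0`. -/
noncomputable def liftX (A : BlockSys s nb n') (y : Fin (mOut s nb) → Bool) (z : Fin n' → Bool) (β : Fin nb)
    (v : Fin (s + 1)) : Bool :=
  if h : v = 0 then false
  else xor (y (outIdx β ⟨(0, v), Fin.pos_of_ne_zero h⟩)) (z (A.avar β 0 v) && z (A.avar β v 0))

/-- The lift of a quotient preimage `z` over the target `y` to an assignment of the `P⋆` instance. -/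
noncomputable def lift (A : BlockSys s nb n') (y : Fin (mOut s nb) → Bool) (z : Fin n' → Bool) :
    Fin (nVars s nb n') → Bool :=
  Fin.append (fun i => liftX A y z (finProdFinEquiv.symm i).1 (finProdFinEquiv.symm i).2) z

/-- The lift on XOR variables. -/
theorem lift_xv (A : BlockSys s nb n') (y : Fin (mOut s nb) → Bool) (z : Fin n' → Bool) (β : Fin nb) (v : Fin (s + 1)) :
    lift A y z (xv β v) = liftX A y z β v := by
  simp only [lift, xv, Fin.append_left, Equiv.symm_apply_apply]

/-- The lift on AND variables. -/
theorem lift_av (A : BlockSys s nb n') (y : Fin (mOut s nb) → Bool) (z : Fin n' → Bool) (a : Fin n') :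
    lift A y z (av a) = z a := by
  simp only [lift, av, Fin.append_right]

/-- Apex outputs of the lift are right. -/
theorem bool_apex (Y P : Bool) : xor (xor false (xor Y P)) P = Y := by
  cases Y <;> cases P <;> rfl

/-- Non-apex outputs of the lift are right, given the apex-triangle equation. -/
theorem bool_bwd (Y₁ Y₂ Y A₁ A₂ A₃ : Bool) (h : xor (xor A₁ A₂) A₃ = xor (xor Y₁ Y₂) Y) :
    xor (xor (xor Y₁ A₁) (xor Y₂ A₂)) A₃ = Y := by
  revert h
  cases Y₁ <;> cases Y₂ <;> cases Y <;> cases A₁ <;> cases A₂ <;> cases A₃ <;> decide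

/-- The third edge of the apex triangle of a non-apex edge is the edge. -/
theorem triEdge₃_edgeTri (e : Edge s) (h : e.1.1 ≠ 0) : triEdge₃ (edgeTri e h) = e := by
  apply Subtype.ext
  simp [triEdge₃, edgeTri]

/-- **(←)** the lift of a quotient preimage is a `P⋆` preimage. -/
theorem pstar_eval_lift (A : BlockSys s nb n') (y : Fin (mOut s nb) → Bool) (z : Fin n' → Bool)
    (hz : (quot A).eval z = xorQuot s nb y) : (pstar A).eval (lift A y z) = y := by
  funext j
  rw [← outIdx_outDec j, pstar_eval_out, lift_xv, lift_xv, lift_av, lift_av]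
  generalize (outDec j).1 = β
  generalize (outDec j).2 = e
  have h2 : e.1.2 ≠ 0 := (lt_of_le_of_lt (Fin.zero_le _) e.2).ne'
  by_cases h0 : e.1.1 = 0
  · have he : (⟨(0, e.1.2), Fin.pos_of_ne_zero h2⟩ : Edge s) = e := Subtype.ext (Prod.ext h0.symm rfl)
    simp only [liftX, h0, h2, dite_true, dite_false]
    rw [he]
    exact bool_apex _ _
  · have key := congrFun hz (triIdx β (edgeTri e h0))
    rw [quot_eval_tri, xorQuot_tri, triEdge₃_edgeTri] at key
    simp only [edgeTri, triEdge₁, triEdge₂, Fin.succ_pred] at key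
    simp only [liftX, h0, h2, dite_false]
    exact bool_bwd _ _ _ _ _ _ key

/-- **B2 (ROUND-22 COR-B): the per-block cycle bridge.**  `π` is an exact quotient of the `P⋆` instance of a block system. -/
theorem blockRange : BlockRange := by
  intro s nb n' A y
  constructor
  · rintro ⟨x, rfl⟩
    exact ⟨fun a => x (av a), (xorQuot_eval_pstar A x).symm⟩
  · rintro ⟨z, hz⟩
    exact ⟨lift A y z, pstar_eval_lift A y z hz⟩

end Summit.PneNP.PneNP.Theorems.QuotientSABlockRange
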